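import Literature.AlgebraicGeometry.RealAlgebraic.PlaneCurveLocalCharts
import HarnessLib

/-!
# Rokhlin's two halves: the non-real locus of a connected nonsingular real plane curve

Topic `Literature/AlgebraicGeometry/RealAlgebraic`; sequel to `DividingCurves.lean` and
`PlaneCurveLocalCharts.lean`. Let `p` be a polynomial in two variables with coefficients mapped
through `ℝ ⊆ ℂ`, whose complex affine curve `A = {p = 0} ⊆ ℂ²` is NONSINGULAR and CONNECTED (for
`p` irreducible over `ℂ` this is the tree's `Literature.NumberTheory.Transcendental.isConnected_zeroLocus_of_isPrime_holds`,
Shafarevich VII §2 Thm. 7.1). **Everything here is proved; no definition and no named fact is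
introduced.**

* `IsHalf.nonRealLocus_subset_union_image_star` — **Rokhlin's two-halves theorem**: for every
  half `H` (connected component of the non-real locus `A ∖ ℝA`), `A ∖ ℝA = H ∪ conj H`. Hence
  any two halves are `H` and `conj H` (`IsHalf.eq_or_eq_image_star`), a DIVIDING curve
  (`IsDividing p`: `A ∖ ℝA` disconnected) has exactly the two disjoint halves `H ≠ conj H`
  (`IsHalf.ne_image_star`, `IsHalf.disjoint_image_star`), and a connected subset of the non-real
  locus together with its conjugate meet every half from exactly one side
  (`IsHalf.subset_or_disjoint_of_image_star`; applied to the two half-discs at a real point this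
  is "every oval is adjacent to both halves, one on each side").

Printed source: Rokhlin 1974 §2 / Degtyarev–Kharlamov 2000 §1 ("`conj` interchanges `A±`"),
Natanzon 2004 Ch. 2 proof of Thm. 1.1 ("the set `P ∖ P^τ` consists of two connected components
`P₁` and `P₂`"), where it is read off the quotient surface `A/conj`. DEVIATION: the tree has no
quotient surface; we run the equivalent clopen argument directly on the connected `A` — the set
`A ∩ closure (H ∪ conj H)` is open in `A` because near a non-real point `A` stays in one half
(`exists_isOpen_inter_subset_half`) and near a real point the non-real points form two
half-discs interchanged by `conj` (`realChart_halfDiscs`), so it is all of `A`.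

## References

* [Rokhlin1974] V. A. Rokhlin, Complex orientations of real algebraic curves, Funct. Anal. Appl.
  8 (1974) 331–334, §2.
* [DegtyarevKharlamov2000] A. Degtyarev, V. Kharlamov, Topological properties of real algebraic
  varieties: du côté de chez Rokhlin, Russian Math. Surveys 55 (2000), arXiv:math/0004134, §1.
* [Natanzon2004] S. Natanzon, Moduli of Riemann Surfaces, Real Algebraic Curves, and Their
  Superanalogs, AMS (2004), Ch. 2 §1.1, proof of Thm. 1.1.
-/

noncomputable section

open MvPolynomial Set Filter Metric
open scoped _root_.Topology _root_.ComplexConjugate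

namespace Literature.AlgebraicGeometry.RealAlgebraic

variable {R : Type*} [CommSemiring R] [Algebra R ℂ] [Algebra R ℝ] [IsScalarTower R ℝ ℂ]
variable (p : MvPolynomial (Fin 2) R)

/-- A complex zero is non-real or a real zero. [folklore] -/
theorem mem_nonRealLocus_or_exists_ofReal {z : Fin 2 → ℂ} (hz : z ∈ complexZeroLocus p) :
    z ∈ nonRealLocus p ∨ ∃ v : Fin 2 → ℝ, aeval v p = 0 ∧ (fun j => (v j : ℂ)) = z := by
  by_cases h : ∃ i, (z i).im ≠ 0
  · exact Or.inl ⟨hz, h⟩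
  · push Not at h
    have hzv : (fun j => (((z j).re : ℝ) : ℂ)) = z := funext fun j => Complex.ext rfl (by simp [h j])
    refine Or.inr ⟨fun j => (z j).re, ?_, hzv⟩
    rw [← ofReal_mem_complexZeroLocus_iff, hzv]
    exact hz

/-- **Half-discs at a real point.** At a real zero `v` of a nonsingular `p` there are an open
`N ∋ v` and two preconnected subsets `U₊`, `U₋` of the non-real locus, interchanged by `conj`,
containing all non-real points of `A ∩ N`, with `A ∩ N ⊆ closure (U₊ ∪ U₋)` (the two half-discs
of a real chart, `realChart_halfDiscs`). [cite: Rokhlin1974, §2] -/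
theorem exists_halfDiscs_nhds (hsm : ∀ w ∈ complexZeroLocus p, ∃ i, aeval w (pderiv i p) ≠ 0)
    {v : Fin 2 → ℝ} (hv : aeval v p = 0) :
    ∃ (N Up Un : Set (Fin 2 → ℂ)), IsOpen N ∧ (fun j => (v j : ℂ)) ∈ N ∧
      Up ⊆ nonRealLocus p ∧ Un ⊆ nonRealLocus p ∧ IsPreconnected Up ∧ IsPreconnected Un ∧
      star '' Up = Un ∧ star '' Un = Up ∧ nonRealLocus p ∩ N ⊆ Up ∪ Un ∧
      complexZeroLocus p ∩ N ⊆ closure (Up ∪ Un) := by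
  have hvA : (fun j => (v j : ℂ)) ∈ complexZeroLocus p := (ofReal_mem_complexZeroLocus_iff p v).2 hv
  obtain ⟨l, hl⟩ := hsm _ hvA
  rw [aeval_ofReal, Complex.ofReal_ne_zero] at hl
  obtain ⟨k, hkl⟩ : ∃ k : Fin 2, k ≠ l := ⟨l + 1, by fin_cases l <;> decide⟩
  obtain ⟨Ω, r, ψ, hΩ, hvΩ, hr, hψa, hψ, huniq⟩ := exists_realChart_aux p v hv hkl hl
  obtain ⟨h1, h2, h3, h4, h5, h6, h7, h8⟩ := realChart_halfDiscs p (fun t ht => (hψa t ht).continuousAt)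
    (fun t ht => ⟨(hψ t ht).1, (hψ t ht).2.1, (hψ t ht).2.2.1, (hψ t ht).2.2.2.1⟩) huniq one_ne_zero
  exact ⟨Ω ∩ {z | z k ∈ ball ((v k : ℂ)) r}, _, _,
    hΩ.inter (isOpen_ball.preimage (continuous_apply k)), ⟨hvΩ, mem_ball_self hr⟩,
    h1, h2, h3, h4, h5, h6, h7, h8⟩

variable {p}

/-- **Rokhlin's two-halves theorem.** If the complex affine curve `A = {p = 0}` is nonsingular
and connected, then for every half `H` the non-real locus is `H ∪ conj H`: the set
`A ∩ closure (H ∪ conj H)` is open in `A` (near a non-real point `A` stays in one half; near a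
real point the non-real points form two half-discs interchanged by `conj`, one of which meets
`H ∪ conj H`), closed and nonempty, hence all of `A`. (Rokhlin 1974 §2; Natanzon 2004, proof of
Thm. 1.1, via the quotient `A/conj` — see the module docstring for the deviation.)
[cite: Rokhlin1974, §2] -/
theorem IsHalf.nonRealLocus_subset_union_image_star (hA : IsPreconnected (complexZeroLocus p))
    (hsm : ∀ w ∈ complexZeroLocus p, ∃ i, aeval w (pderiv i p) ≠ 0) {H : Set (Fin 2 → ℂ)}
    (hH : IsHalf p H) : nonRealLocus p ⊆ H ∪ star '' H := by
  have hH₂ : IsHalf p (star '' H) := hH.image_star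
  set S := H ∪ star '' H with hS
  have hSNR : S ⊆ nonRealLocus p := union_subset hH.subset hH₂.subset
  have hSA : S ⊆ complexZeroLocus p := hSNR.trans (nonRealLocus_subset_complexZeroLocus p)
  -- a half meeting `S` lies in `S`
  have hhalf : ∀ y ∈ S, half p y ⊆ S := by
    rintro y (hy | hy)
    · rw [← hH.eq_half hy]; exact subset_union_left
    · rw [← hH₂.eq_half hy]; exact subset_union_right
  have hstarS : star '' S ⊆ S := by
    rintro _ ⟨y, hy, rfl⟩
    rcases hy with hy | hy
    · exact Or.inr ⟨y, hy, rfl⟩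
    · obtain ⟨y', hy', rfl⟩ := hy
      rw [star_star]; exact Or.inl hy'
  -- Step 1: non-real points of the closure of `S` have a neighbourhood with `A ∩ N ⊆ S`
  have step1 : ∀ z ∈ nonRealLocus p, z ∈ closure S →
      ∃ N : Set (Fin 2 → ℂ), IsOpen N ∧ z ∈ N ∧ complexZeroLocus p ∩ N ⊆ S := by
    intro z hz hzc
    obtain ⟨N, hN, hzN, hsub⟩ := exists_isOpen_inter_subset_half p hsm hz
    obtain ⟨y, hyN, hyS⟩ := mem_closure_iff.1 hzc N hN hzN
    have hy : y ∈ half p z := hsub ⟨hSA hyS, hyN⟩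
    refine ⟨N, hN, hzN, hsub.trans ?_⟩
    rw [half_eq_of_mem hy]
    exact hhalf y hyS
  -- Step 2: real points of the closure of `S` have a neighbourhood with `A ∩ N ⊆ closure S`
  have step2 : ∀ v : Fin 2 → ℝ, aeval v p = 0 → (fun j => (v j : ℂ)) ∈ closure S →
      ∃ N : Set (Fin 2 → ℂ), IsOpen N ∧ (fun j => (v j : ℂ)) ∈ N ∧
        complexZeroLocus p ∩ N ⊆ closure S := by
    intro v hv hvc
    obtain ⟨N, Up, Un, hN, hvN, hUp, hUn, hUpc, hUnc, hsUp, hsUn, hNR, hcl⟩ :=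
      exists_halfDiscs_nhds p hsm hv
    obtain ⟨y, hyN, hyS⟩ := mem_closure_iff.1 hvc N hN hvN
    have hy : y ∈ Up ∪ Un := hNR ⟨hSNR hyS, hyN⟩
    -- the half-disc containing `y` lies in `S`, and so does its conjugate
    have key : ∀ {U U' : Set (Fin 2 → ℂ)}, IsPreconnected U → U ⊆ nonRealLocus p →
        star '' U = U' → y ∈ U → U ∪ U' ⊆ S := by
      intro U U' hUc hUsub hUU' hyU
      have hUS : U ⊆ S := (subset_half_of_isPreconnected hUc hUsub hyU).trans (hhalf y hyS)
      refine union_subset hUS ?_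
      rw [← hUU']
      exact (image_mono hUS).trans hstarS
    refine ⟨N, hN, hvN, hcl.trans (closure_mono ?_)⟩
    rcases hy with hy | hy
    · exact key hUpc hUp hsUp hy
    · rw [union_comm]; exact key hUnc hUn hsUn hy
  -- Step 3: together
  have step3 : ∀ z ∈ complexZeroLocus p, z ∈ closure S →
      ∃ N : Set (Fin 2 → ℂ), IsOpen N ∧ z ∈ N ∧ complexZeroLocus p ∩ N ⊆ closure S := by
    intro z hz hzc
    rcases mem_nonRealLocus_or_exists_ofReal p hz with hz' | ⟨v, hv, rfl⟩
    · obtain ⟨N, hN, hzN, hsub⟩ := step1 z hz' hzc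
      exact ⟨N, hN, hzN, hsub.trans subset_closure⟩
    · exact step2 v hv hzc
  -- Step 4: the clopen argument in the preconnected `A`
  set U : Set (Fin 2 → ℂ) := {z | ∃ N : Set (Fin 2 → ℂ), IsOpen N ∧ z ∈ N ∧
    complexZeroLocus p ∩ N ⊆ closure S} with hU
  have hUo : IsOpen U := by
    refine isOpen_iff_forall_mem_open.2 fun z ⟨N, hN, hzN, hsub⟩ => ⟨N, fun z' hz' => ⟨N, hN, hz', hsub⟩, hN, hzN⟩
  have hAcl : complexZeroLocus p ⊆ closure S := by
    intro z hz
    by_contra hzc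
    obtain ⟨w, hw⟩ := hH.nonempty
    have hwU : w ∈ U := by
      obtain ⟨N, hN, hwN, hsub⟩ := step3 w (hSA (Or.inl hw)) (subset_closure (Or.inl hw))
      exact ⟨N, hN, hwN, hsub⟩
    have hcover : complexZeroLocus p ⊆ U ∪ (closure S)ᶜ := fun y hy => by
      by_cases hyc : y ∈ closure S
      · obtain ⟨N, hN, hyN, hsub⟩ := step3 y hy hyc
        exact Or.inl ⟨N, hN, hyN, hsub⟩
      · exact Or.inr hyc
    obtain ⟨y, hyA, ⟨N, hN, hyN, hsub⟩, hyc⟩ := hA U (closure S)ᶜ hUo isClosed_closure.isOpen_compl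
      hcover ⟨w, hSA (Or.inl hw), hwU⟩ ⟨z, hz, hzc⟩
    exact hyc (hsub ⟨hyA, hyN⟩)
  -- Step 5: conclusion
  intro z hz
  obtain ⟨N, hN, hzN, hsub⟩ := step1 z hz (hAcl (nonRealLocus_subset_complexZeroLocus p hz))
  exact hsub ⟨nonRealLocus_subset_complexZeroLocus p hz, hzN⟩

/-- **Any two halves are `H` and `conj H`** (connected nonsingular curve). [cite: Rokhlin1974, §2] -/
theorem IsHalf.eq_or_eq_image_star (hA : IsPreconnected (complexZeroLocus p))
    (hsm : ∀ w ∈ complexZeroLocus p, ∃ i, aeval w (pderiv i p) ≠ 0) {H H' : Set (Fin 2 → ℂ)}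
    (hH : IsHalf p H) (hH' : IsHalf p H') : H' = H ∨ H' = star '' H := by
  obtain ⟨w, hw⟩ := hH'.nonempty
  rcases hH.nonRealLocus_subset_union_image_star hA hsm (hH'.subset hw) with h | h
  · exact Or.inl ((hH'.eq_half hw).trans (hH.eq_half h).symm)
  · exact Or.inr ((hH'.eq_half hw).trans (hH.image_star.eq_half h).symm)

/-- **A dividing connected nonsingular curve has exactly two halves**: `H ≠ conj H`.
[cite: Rokhlin1974, §2] -/
theorem IsHalf.ne_image_star (hA : IsPreconnected (complexZeroLocus p))
    (hsm : ∀ w ∈ complexZeroLocus p, ∃ i, aeval w (pderiv i p) ≠ 0) (hdiv : IsDividing p)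
    {H : Set (Fin 2 → ℂ)} (hH : IsHalf p H) : H ≠ star '' H := by
  intro heq
  apply hdiv
  have hsub := hH.nonRealLocus_subset_union_image_star hA hsm
  rw [← heq, union_self] at hsub
  rw [Subset.antisymm hsub hH.subset]
  exact hH.isConnected.isPreconnected

/-- The two halves of a dividing connected nonsingular curve are disjoint. [cite: Rokhlin1974, §2] -/
theorem IsHalf.disjoint_image_star (hA : IsPreconnected (complexZeroLocus p))
    (hsm : ∀ w ∈ complexZeroLocus p, ∃ i, aeval w (pderiv i p) ≠ 0) (hdiv : IsDividing p)
    {H : Set (Fin 2 → ℂ)} (hH : IsHalf p H) : Disjoint H (star '' H) :=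
  (hH.eq_or_disjoint hH.image_star).resolve_left (hH.ne_image_star hA hsm hdiv)

/-- **Each half lies on exactly one side.** For a dividing connected nonsingular curve, a
nonempty preconnected subset `U` of the non-real locus and its conjugate `conj U` meet every half
`H` from exactly one side: `U ⊆ H` and `conj U ∩ H = ∅`, or `U ∩ H = ∅` and `conj U ⊆ H`.
Applied to the two half-discs at a real point (`realChart_halfDiscs`): every oval is adjacent to
both halves, one on each side. [cite: Rokhlin1974, §2] -/
theorem IsHalf.subset_or_disjoint_of_image_star (hA : IsPreconnected (complexZeroLocus p))
    (hsm : ∀ w ∈ complexZeroLocus p, ∃ i, aeval w (pderiv i p) ≠ 0) (hdiv : IsDividing p)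
    {H : Set (Fin 2 → ℂ)} (hH : IsHalf p H) {U : Set (Fin 2 → ℂ)} (hU : IsPreconnected U)
    (hUsub : U ⊆ nonRealLocus p) (hUne : U.Nonempty) :
    (U ⊆ H ∧ Disjoint (star '' U) H) ∨ (Disjoint U H ∧ star '' U ⊆ H) := by
  obtain ⟨w, hw⟩ := hUne
  have hUw : U ⊆ half p w := subset_half_of_isPreconnected hU hUsub hw
  have hdisj := hH.disjoint_image_star hA hsm hdiv
  rcases hH.eq_or_eq_image_star hA hsm (isHalf_half (hUsub hw)) with h | h
  · rw [h] at hUw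
    exact Or.inl ⟨hUw, hdisj.symm.mono_left (image_mono hUw)⟩
  · rw [h] at hUw
    refine Or.inr ⟨hdisj.symm.mono_left hUw, ?_⟩
    calc star '' U ⊆ star '' (star '' H) := image_mono hUw
      _ = H := image_star_image_star H

end Literature.AlgebraicGeometry.RealAlgebraic
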